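/-
Copyright (c) 2026. All rights reserved.
Released under Apache 2.0 license as described in the file LICENSE.
Authors: abc-iut cell, seat abc-iut-L4-t5 (gen 4; block W2-B1, [AbsTopIII] Cor 3.6 at the model).
-/
import Literature.AnabelianGeometry.AbsoluteAnabelian.AbsTopIII.FrobeniusPictureMLFInputs
import Literature.AnabelianGeometry.AbsoluteAnabelian.AbsTopIII.MLFGaloisModelIdRigid
import Literature.AnabelianGeometry.AbsoluteAnabelian.AbsTopIII.MLFLogFrobeniusFunctors
import HarnessLib

/-!
# [AbsTopIII] Corollary 3.6 AT THE MODEL: `𝒳`, `𝒩`, `ℰ`, `log`, `λ^×`, `λ^{×pf}`, `ι_log`, `ι_×` real;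
# Lemma 3.4 and Prop 3.2 (iv) discharged; the one residual input is Cor 1.10

S. Mochizuki, *Topics in absolute anabelian geometry III* [MochizukiAbsTopIII2015] (kurims manuscript
`paper:url-5493eb38cbb7`), Cor 3.6 pp. 78–82 over Def 3.1 (iii), (iv), (vi) pp. 67–70; Lemma 3.4 p. 74;
Prop 3.2 (iv) p. 72.  Capstone of block W2-B1 (abc-iut-L4-t5): the typed Cor 3.6 (`LogFrobeniusData.*`,
`FrobeniusPictureMLF*.lean`) was proved over abstract input data and then over inputs "in the shape of
Def 3.1" (`MonoAnabelianLogFrobeniusData`, `FrobeniusPictureMLFInputs.lean`: `φ_An` an equivalence PROVED,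
(ii) unconditional, (i)–(v) from exactly the Lemma-3.4 property + `IsIdRigid 𝒳` + an object).  Here the
Def-3.1 inputs are INSTANTIATED by the cell's MODEL (abc-iut-L4-t9, `MLFGaloisModelCategories.lean` /
`MLFLogFrobeniusFunctors.lean`: `𝒳 = TFModel p` the model MLF-Galois `TF`-pairs `(Π_k ↠ G_k ↷ ℚ̄_p)` with
Galois-isomorphisms, `𝒩 = TSObj`, the functors `(Π ↷ M) ↦ Π`, `λ^×`, `λ^{×pf}`, `ι_×`, `ι_log`, and
`log_{TF,TF} = 𝟭` in log-coordinates), restricted to a full subcategory `𝒳_P` ("`𝒞^{MLF-sB}_T`": print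
restricts to pairs OF STRICTLY BELYI TYPE; the tree has no étale `π₁`, so the type `P` is a parameter, of
which the one printed consequence used is recorded as the hypothesis `hP`: `Π` slim, proof of
Prop 3.2 (iv) p. 72), with `ℰ := 𝒯𝒢^{P}` the essential image of `(Π ↷ M) ↦ Π` on `𝒳_P` (print's `𝒯𝒢_sB`,
Def 3.1 (iii), read up to isomorphism of topological groups) and `𝒩_P` the `TS`-pairs whose group lies in it.

RESULT (`TFModel.logFrobeniusCompatible_model`): for every such `P` and every **Cor-1.10 datum** over the
`P`-part — a functor `alg : ℰ → 𝒟` ("the 'group-theoretic' algorithm `Π ↦ (Π ↷ {k̄^× ↪ lim H¹})`",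
Def 3.1 (vi)) with the assignment `forget : 𝒟 → 𝒳_P` of Cor 3.6 (ii), `algOver`, and the Kummer
comparison `η_An` ("arising from [...] Corollary 1.10 [cf. also Proposition 3.2, (ii), (iii)]", p. 79),
packaged as `TFModel.AnabelianInput` — and every object of `𝒳_P`, ALL FIVE statements of the typed
Cor 3.6 hold for the model data: (i) cores, (ii) the telecore `𝔗_An` with its contact structure, (iii)
observables, (iv) both incompatibilities — the Lemma-3.4 property being a THEOREM at the model
(`lemma34_model`, from abc-iut-L4-t9's `iotaLogMap_ne_timesToPf_prime`: `ι_log` lands in `(𝒪^×_k̄)^pf`,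
`[p]` does not) — and (v) nexus, total `□`-rigidity — `IsIdRigid 𝒳_P` being a THEOREM at the model
(abc-iut-L4-t9's `TFModel.isIdRigid_fullSubcategory_of_slim`, `MLFGaloisModelIdRigid.lean`, Prop 3.2 (iv)) — and the `ℤ`-shifts.
`AnabelianInput.ofEmpty` records that the input structure is formally satisfiable (at an empty type
`P`); at the intended `P` it is [AbsTopIII] Cor 1.10 for curves of strictly Belyi type over MLF's, which
this file does NOT assert (for mono-analytic pairs `Π_k = G_k` it would even be false: `G_k` does not
determine `k`).

HONEST FRAMING: refereed pre-IUT material; kernel constructions and proofs over the cell's model of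
Def 3.1; the anabelian content (Cor 1.10) is an explicit parameter; nothing here bears on [IUTchIII]
Cor. 3.12 or takes a side; typed ≠ discharged except for the theorems of this file.
-/

set_option autoImplicit false

noncomputable section

namespace Literature.AnabelianGeometry.AbsoluteAnabelian.AbsTopIII

open CategoryTheory
open Literature.AlgebraicGeometry.Frobenioids (IsSlimGroup)

namespace TFModel

variable (p : ℕ) [Fact p.Prime] (P : ObjectProperty (TFModel p))

/-! ## The `P`-part of the model: `𝒳_P`, `ℰ = 𝒯𝒢^{P}`, `𝒩_P` and the restricted functors -/

/-- `(Π ↷ M) ↦ Π` on the `P`-part `𝒳_P` of the model category (Def 3.1 (iii)).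
[cite: MochizukiAbsTopIII2015, Definition 3.1 (iii) p.68] -/
abbrev galP : P.FullSubcategory ⥤ TopGroupObj := P.ι ⋙ TFModel.gal p

/-- **`ℰ = 𝒯𝒢^{P}`**: the full subcategory of (double-underlined) `𝒯𝒢` on the topological groups
isomorphic to `Π` for some `(Π ↷ M)` of type `P` (the essential image of `(Π ↷ M) ↦ Π` on `𝒳_P`).
For `P` = "of strictly Belyi type" this models print's `𝒯𝒢_sB` of Def 3.1 (iii): "`𝒯𝒢 ⊇ 𝒯𝒢_hyp ⊇
𝒯𝒢_sB` for the subcategories determined, respectively, by the étale fundamental groups of arbitrary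
hyperbolic orbicurves over MLF's and the étale fundamental groups of hyperbolic orbicurves of
strictly Belyi type over MLF's [...] also, we shall use the same notation, except with `𝒯𝒢`
replaced by [double-underlined] `𝒯𝒢` to denote the various subcategories determined by the
isomorphisms" — read here as the isomorphism-closed full subcategory of double-underlined `𝒯𝒢` on
those groups (a reading, not a quotation: print's "subcategory determined by" is taken up to
isomorphism of topological groups). [cite: MochizukiAbsTopIII2015, Definition 3.1 (iii) p.68] -/
abbrev GalImage : Type 1 := (galP p P).EssImageSubcategory

/-- The projection `𝒳_P → ℰ`, `(Π ↷ M) ↦ Π`. [cite: MochizukiAbsTopIII2015, Definition 3.1 (iii) p.68] -/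
abbrev toGalImage : P.FullSubcategory ⥤ GalImage p P := (galP p P).toEssImage

/-- **`𝒩_P`**: the `TS`-pairs of the model whose topological group lies in `ℰ = 𝒯𝒢^{P}`.
[cite: MochizukiAbsTopIII2015, Definition 3.1 (iii) p.68] -/
abbrev SpaceOver : Type 1 := ((galP p P).essImage.inverseImage TSObj.gal).FullSubcategory

/-- The projection `𝒩_P → ℰ`, `(Π ↷ M) ↦ Π`. [cite: MochizukiAbsTopIII2015, Definition 3.1 (iii) p.68] -/
def spaceToGalImage : SpaceOver p P ⥤ GalImage p P :=
  (galP p P).essImage.lift (((galP p P).essImage.inverseImage TSObj.gal).ι ⋙ TSObj.gal)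
    fun n => n.property

/-- **`λ^× : 𝒳_P → 𝒩_P`** (abc-iut-L4-t9's model functor `λ^×` restricted to the `P`-part; its value
`(Π ↷ k̄^×)` has group `Π ∈ ℰ`). [cite: MochizukiAbsTopIII2015, Definition 3.1 (iv) p.69] -/
def lamTimesP : P.FullSubcategory ⥤ SpaceOver p P :=
  ObjectProperty.lift _ (P.ι ⋙ TFModel.lamTimes p) fun x => Functor.obj_mem_essImage (galP p P) x

/-- **`λ^{×pf} : 𝒳_P → 𝒩_P`** (restriction of the model functor `λ^{×pf}`).
[cite: MochizukiAbsTopIII2015, Definition 3.1 (iv) p.69] -/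
def lamPfP : P.FullSubcategory ⥤ SpaceOver p P :=
  ObjectProperty.lift _ (P.ι ⋙ TFModel.lamTimesPf p) fun x => Functor.obj_mem_essImage (galP p P) x

/-- `λ^×` lies over `ℰ` ON THE NOSE: `λ^× ⋙ (𝒩_P → ℰ) = (𝒳_P → ℰ)` (the group of `(Π ↷ k̄^×)` IS `Π`).
[cite: MochizukiAbsTopIII2015, Definition 3.1 (iii) p.68] -/
theorem lamTimesP_spaceToGalImage : lamTimesP p P ⋙ spaceToGalImage p P = toGalImage p P :=
  CategoryTheory.Functor.hext (fun _ => rfl) fun _ _ _ => by rfl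

/-- `λ^{×pf}` lies over `ℰ` on the nose. [cite: MochizukiAbsTopIII2015, Definition 3.1 (iii) p.68] -/
theorem lamPfP_spaceToGalImage : lamPfP p P ⋙ spaceToGalImage p P = toGalImage p P :=
  CategoryTheory.Functor.hext (fun _ => rfl) fun _ _ _ => by rfl

/-- **`ι_× : λ^× → λ^{×pf}`** on the `P`-part (restriction of the model transformation).
[cite: MochizukiAbsTopIII2015, Definition 3.1 (iv) p.69] -/
def iotaTimesP : lamTimesP p P ⟶ lamPfP p P where
  app x := ObjectProperty.homMk ((TFModel.iotaTimes p).app x.obj)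
  naturality _ _ f := ObjectProperty.hom_ext _ ((TFModel.iotaTimes p).naturality f.hom)

/-- **`ι_log : λ^× ∘ log_{TF,TF} → λ^{×pf}`** on the `P`-part, with `log_{TF,TF} = 𝟭` (log-coordinates,
abc-iut-L4-t9's model: "`log_{TF,TF}` is isomorphic to the identity functor", Def 3.1 (iv)).
[cite: MochizukiAbsTopIII2015, Definition 3.1 (iv) p.69] -/
def iotaLogP : 𝟭 P.FullSubcategory ⋙ lamTimesP p P ⟶ lamPfP p P where
  app x := ObjectProperty.homMk ((TFModel.iotaLog p).app x.obj)
  naturality _ _ f := ObjectProperty.hom_ext _ ((TFModel.iotaLog p).naturality f.hom)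

/-! ## The Cor-1.10 input over the `P`-part and the resulting `MonoAnabelianLogFrobeniusData` -/

/-- **The anabelian input of Cor 3.6 over the `P`-part of the model** — the data this file does NOT
construct: a category `𝒟` of the data "`Π ↷ {k̄^× ↪ lim→_J H¹(J, μ_Ẑ(Π))}` [...] equipped with its
topological field structure" (Def 3.1 (vi)), the "group-theoretic" algorithm of Cor 1.10 (d), (h) as a
functor `alg : ℰ → 𝒟`, the assignment "`(Π, Π ↷ {…}) ↦ (Π ↷ 𝒪^⊳_k̄), (Π ↷ k̄^× ∪ {0})`" of Cor 3.6 (ii)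
as `forget : 𝒟 → 𝒳_P` lying over `ℰ` (`algOver`), and the comparison "`η_An : φ_An ∘ π_An ⥲ id_𝒳`
[...] arising from the 'group-theoretic' algorithms of Corollary 1.10" (p. 79) (`ηAn`).  For `P` = "of
strictly Belyi type" this is [AbsTopIII] Cor 1.10; it is a parameter here, not asserted.
[cite: MochizukiAbsTopIII2015, Corollary 3.6 (ii) p.79] -/
structure AnabelianInput (D : Type 1) [Category.{1} D] : Type 2 where
  /-- The Cor-1.10 algorithm `Π ↦ (Π ↷ {k̄^× ↪ lim→_J H¹(J, μ_Ẑ(Π))})` as a functor on `ℰ`. -/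
  alg : GalImage p P ⥤ D
  /-- The assignment `(Π, Π ↷ {…}) ↦ (Π ↷ k̄)` of Cor 3.6 (ii), valued in the `P`-part of the model. -/
  forget : D ⥤ P.FullSubcategory
  /-- The pair produced from `Π` has underlying group `Π`. -/
  algOver : (alg ⋙ forget) ⋙ toGalImage p P ≅ 𝟭 (GalImage p P)
  /-- The Kummer comparison `η_An`. -/
  ηAn : toGalImage p P ⋙ (alg ⋙ forget) ≅ 𝟭 P.FullSubcategory

variable {p P}
variable {D : Type 1} [Category.{1} D]

/-- **The Def-3.1-shaped input record of Cor 3.6, INSTANTIATED by the model**: `𝒳 := 𝒳_P`,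
`𝒩 := 𝒩_P`, `ℰ := 𝒯𝒢^{P}`, the projections `(Π ↷ M) ↦ Π`, `log := 𝟭` with `log ≅ 𝟭` the identity
(log-coordinates), `λ^×`, `λ^{×pf}` (over `ℰ` on the nose), `ι_log`, `ι_×` (the present §3 direction,
flag `inl`), and the anabelian input `(𝒟, alg, forget, algOver, η_An)`.
[cite: MochizukiAbsTopIII2015, Corollary 3.6 pp.78–79] -/
def monoAnabelianData (I : AnabelianInput p P D) : MonoAnabelianLogFrobeniusData.{1} where
  X := P.FullSubcategory
  N := SpaceOver p P
  E := GalImage p P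
  D := D
  XtoE := toGalImage p P
  NtoE := spaceToGalImage p P
  log := 𝟭 _
  logIsoId := Iso.refl _
  lamTimes := lamTimesP p P
  lamPf := lamPfP p P
  lamTimes_NtoE := lamTimesP_spaceToGalImage p P
  lamPf_NtoE := lamPfP_spaceToGalImage p P
  ιlog := iotaLogP p P
  ιtimes := Sum.inl (iotaTimesP p P)
  alg := I.alg
  forget := I.forget
  algOver := I.algOver
  ηAn := I.ηAn

/-- The `𝒳` of the model data is the `P`-part `𝒳_P`. [cite: MochizukiAbsTopIII2015, Corollary 3.6 p.78] -/
theorem monoAnabelianData_X (I : AnabelianInput p P D) : (monoAnabelianData I).X = P.FullSubcategory := rfl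

/-- The direction flag of `ι_×` is `inl` (the present §3 direction `λ^× → λ^{×pf}`).
[cite: MochizukiAbsTopIII2015, Definition 3.1 (iv) p.69] -/
theorem monoAnabelianData_ιtimes (I : AnabelianInput p P D) :
    (monoAnabelianData I).ιtimes = Sum.inl (iotaTimesP p P) := rfl

/-! ## Lemma 3.4 at the model; Cor 3.6 (i)–(v) at the model -/

/-- **The Lemma-3.4 property HOLDS at the model, at every object** (Lemma 3.4 p. 74 as used in the proof
of Cor 3.6 (iv) p. 81: "we obtain a contradiction to Lemma 3.4"): for every `(Π ↷ k̄)` of type `P` and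
every morphism `a : x → log x = x` (isomorphism or not), `λ^×(a) ≫ ι_{log,x} ≠ ι_{×,x}` — evaluate at
`p ∈ k̄^×`: the left side lands in `(𝒪^×_k̄)^pf` (abc-iut-L4-t9's `iotaLogMap_ne_timesToPf_prime`), the
right side is `[p]`. [cite: MochizukiAbsTopIII2015, Lemma 3.4 p.74] -/
theorem lemma34_model (I : AnabelianInput p P D) :
    ∀ (x : (monoAnabelianData I).X) (a : x ⟶ (monoAnabelianData I).log.obj x), IsIso a →
      (monoAnabelianData I).lamTimes.map a ≫ (monoAnabelianData I).ιlog.app x ≠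
        (iotaTimesP p P).app x := by
  intro x a _ h
  have h1 := congrArg
    (fun φ : (lamTimesP p P).obj x ⟶ (lamPfP p P).obj x => (φ.hom : TSObj.Hom _ _).homM (primeTimes p)) h
  exact iotaLogMap_ne_timesToPf_prime _ h1

/-- The Lemma-3.4 property in abc-iut-L4-t5's typed form `LogFrobeniusData.Lemma34Property`, at the model.
[cite: MochizukiAbsTopIII2015, Lemma 3.4 p.74] -/
theorem lemma34Property_model (I : AnabelianInput p P D) :
    LogFrobeniusData.Lemma34Property (Δ := (monoAnabelianData I).toLogFrobeniusData) (iotaTimesP p P) :=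
  ((monoAnabelianData I).lemma34Property_iff (iotaTimesP p P)).2 (lemma34_model I)

/-- **[AbsTopIII] Cor 3.6 (ii) at the model — UNCONDITIONAL given the Cor-1.10 datum**: the telecore
`𝔗_An` with its contact structure `ℋ_An` exists for the model data (`MonoAnabelianLogFrobeniusData.telecoreStmt`).
[cite: MochizukiAbsTopIII2015, Corollary 3.6 (ii) pp.79–80] -/
theorem telecoreStmt_model (I : AnabelianInput p P D) :
    (monoAnabelianData I).toLogFrobeniusData.TelecoreStmt (monoAnabelianData I).telecoreData :=
  (monoAnabelianData I).telecoreStmt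

/-- **[AbsTopIII] Cor 3.6 (iv) at the model, first incompatibility — Lemma 3.4 DISCHARGED**: for the
model data the families of homotopies of the core `(𝒟_{≤3}, ℰ)` and of the observable `𝔖_log` are not
simultaneously compatible. [cite: MochizukiAbsTopIII2015, Corollary 3.6 (iv) p.80] -/
theorem incompatibleStmt_model (I : AnabelianInput p P D) (x₀ : P.FullSubcategory) :
    (monoAnabelianData I).toLogFrobeniusData.IncompatibleStmt :=
  (monoAnabelianData I).toLogFrobeniusData.incompatibleStmt_of_lemma34 (iotaTimesP p P) rfl x₀
    (lemma34Property_model I)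

/-- **[AbsTopIII] Cor 3.6 (iv) at the model, second incompatibility — Lemma 3.4 DISCHARGED**: the
telecore `𝔗_An`, its contact structure `ℋ_An` and `𝔖_log` are not simultaneously compatible.
[cite: MochizukiAbsTopIII2015, Corollary 3.6 (iv) p.80] -/
theorem telecoreIncompatibleStmt_model (I : AnabelianInput p P D) (x₀ : P.FullSubcategory) :
    (monoAnabelianData I).toLogFrobeniusData.TelecoreIncompatibleStmt (monoAnabelianData I).telecoreData :=
  (monoAnabelianData I).toLogFrobeniusData.telecoreIncompatibleStmt_of_lemma34
    (monoAnabelianData I).telecoreData (iotaTimesP p P) rfl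
    ((Anab.κAn (monoAnabelianData I).alg).obj ((toGalImage p P).obj x₀)) (lemma34Property_model I)

/-- **[AbsTopIII] Cor 3.6 (v) at the model, nexus and total `□`-rigidity — Prop 3.2 (iv) DISCHARGED**:
for a type `P` of pairs with slim `Π` (print: pairs of strictly Belyi type), `□` is a nexus and `𝒟` is
totally `□`-rigid for the model data (`IsIdRigid 𝒳_P` is abc-iut-L4-t9's `TFModel.isIdRigid_fullSubcategory_of_slim`).
[cite: MochizukiAbsTopIII2015, Corollary 3.6 (v) pp.80–82] -/
theorem nexusRigidStmt_model (hP : ∀ A : TFModel p, P A → IsSlimGroup A.pair.Pi)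
    (I : AnabelianInput p P D) : (monoAnabelianData I).toLogFrobeniusData.NexusRigidStmt :=
  (monoAnabelianData I).nexusRigidStmt (isIdRigid_fullSubcategory_of_slim P hP)

/-- **[AbsTopIII] Cor 3.6 (i)–(v) AT THE MODEL.**  For every type `P` of model MLF-Galois `TF`-pairs
with slim `Π` (print: of strictly Belyi type), every Cor-1.10 datum `I` over the `P`-part, and an
object `x₀` of `𝒳_P`, the assembled typed Cor 3.6 `LogFrobeniusCompatible` holds for the model data and
its printed telecore datum `⟨φ_An, 𝟙, η_An⟩`: (i) the cores `(𝒟_{≤4}, Anab)`, `(𝒟_{≤5}, ℰ)`,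
`(𝒟_{≤6}, 𝒩)`; (ii) the telecore `𝔗_An` and contact structure `ℋ_An`; (iii) the observable `𝔖_log`;
(iv) both incompatibilities; (v) nexus, total `□`-rigidity and the `ℤ`-action by shifts — with the two
printed model inputs Lemma 3.4 and Prop 3.2 (iv) now THEOREMS of the tree, leaving exactly Cor 1.10 (`I`)
as input. [cite: MochizukiAbsTopIII2015, Corollary 3.6 (i)–(v) pp.78–82] -/
theorem logFrobeniusCompatible_model (hP : ∀ A : TFModel p, P A → IsSlimGroup A.pair.Pi)
    (I : AnabelianInput p P D) (x₀ : P.FullSubcategory) :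
    (monoAnabelianData I).toLogFrobeniusData.LogFrobeniusCompatible (monoAnabelianData I).telecoreData :=
  (monoAnabelianData I).logFrobeniusCompatible (iotaTimesP p P) rfl (lemma34_model I)
    (isIdRigid_fullSubcategory_of_slim P hP) x₀

/-! ## Formal satisfiability of the input structure -/

/-- A functor out of a category without objects (bookkeeping for `AnabelianInput.ofEmpty`).
[cite: MochizukiAbsTopIII2015, Corollary 3.6 (ii) p.79] -/
def functorOfIsEmpty (C : Type 1) [Category.{1} C] [IsEmpty C] (C' : Type 1) [Category.{1} C'] :
    C ⥤ C' where
  obj x := isEmptyElim x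
  map {x} _ := isEmptyElim x
  map_id x := isEmptyElim x
  map_comp {x} _ _ := isEmptyElim x

/-- If no model object has type `P`, then `𝒳_P` has no objects.
[cite: MochizukiAbsTopIII2015, Corollary 3.6 p.78] -/
theorem isEmpty_fullSubcategory (hP : ∀ A : TFModel p, ¬ P A) : IsEmpty P.FullSubcategory :=
  ⟨fun x => hP x.obj x.property⟩

/-- If no model object has type `P`, then `ℰ = 𝒯𝒢^{P}` has no objects.
[cite: MochizukiAbsTopIII2015, Definition 3.1 (vi) p.70] -/
theorem isEmpty_galImage (hP : ∀ A : TFModel p, ¬ P A) : IsEmpty (GalImage p P) :=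
  ⟨fun e => by
    obtain ⟨x, _⟩ := e.property
    exact hP x.obj x.property⟩

/-- **Formal satisfiability of `AnabelianInput`** (honest-scope bookkeeping, NOT a model of Cor 1.10):
for a type `P` satisfied by no object, the empty functors furnish an anabelian input (so the hypotheses
of `logFrobeniusCompatible_model` are jointly consistent; at the intended `P` the input is
[AbsTopIII] Cor 1.10, which is not constructed in the tree). [cite: MochizukiAbsTopIII2015, Corollary 3.6 (ii) p.79] -/
def AnabelianInput.ofEmpty (hP : ∀ A : TFModel p, ¬ P A) :
    AnabelianInput p P P.FullSubcategory :=
  haveI := isEmpty_fullSubcategory (P := P) hP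
  haveI := isEmpty_galImage (P := P) hP
  { alg := functorOfIsEmpty (GalImage p P) P.FullSubcategory
    forget := 𝟭 _
    algOver := NatIso.ofComponents (fun e => isEmptyElim e) (fun {e} => isEmptyElim e)
    ηAn := NatIso.ofComponents (fun x => isEmptyElim x) (fun {x} => isEmptyElim x) }

end TFModel

end Literature.AnabelianGeometry.AbsoluteAnabelian.AbsTopIII

end
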